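import Mathlib.Analysis.Complex.JensenFormula
import Mathlib.Analysis.SpecialFunctions.Log.PosLog
import Mathlib.Analysis.SpecialFunctions.Integrals.Basic
import Mathlib.MeasureTheory.Integral.IntegralEqImproper
import Summits.RiemannHypothesis.RiemannHypothesis.Theorems.WeilWindowFlowStrictUnderRHJensen
import HarnessLib

/-!
# Sharp upper density of the real zeros of an entire function of exponential type, I:
# the averaging kernel and Jensen's formula on discs centred on the real axis
# (crux `WindowStep`, line `split-birth`, stub `stub_realZeroDensityOfLogInt`, auxiliary file)

Support file for the crux `stmt-RiemannHypothesis-14659`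
(`Summit.RiemannHypothesis.RiemannHypothesis.Theses.SpectralTrace.WindowStep`), line `split-birth`,
registered stub `stub_realZeroDensityOfLogInt` (pure complex analysis, RH-free).

**Theorem.** Let `F` be entire with `‖F z‖ ≤ K e^{B |Im z|}` (`K ≥ 1`, `B ≥ 0`), `F c ≠ 0` for some
real `c`, and `∫ log⁺(1/|F(x)|) dx/(1+x²) < ∞`. Then for every `η > 0` there is `r₀` such that every
finite set of real zeros of `F` in `[-r, r]`, `r ≥ r₀`, has at most `(2B/π + η) r` elements — the upper
half of the Levinson–Cartwright theorem (Boas, *Entire Functions*, Thm 8.4.16) for REAL zeros.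

This file: §1 the two elementary integrals `∫_0^{2π} |sin θ| dθ = 4` and
`∫_{-R}^{R} log⁺(R/|s|) ds = 2R` (with interval integrability of the kernel `log⁺(R/|λ − x|)`);
§2 for every real `x₀` with `F x₀ ≠ 0`, Jensen's formula on `|z − x₀| ≤ R`
(Mathlib `AnalyticOnNhd.circleAverage_log_norm`) and `log |F| ≤ log K + B R |sin θ|` on the circle
give `Σ_{λ ∈ Z} log⁺(R/|λ − x₀|) ≤ log K + 2BR/π + log⁺(1/|F x₀|)` for every finite set `Z` of real
zeros (`sum_posLog_le_of_expType`). The averaging over `x₀` and the density bound are in the sequel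
`SpectralTraceWindowStepStubRealZeroDensityOfLogInt.lean`.
-/

set_option linter.dupNamespace false

noncomputable section

open Complex Set Filter MeasureTheory Metric Real intervalIntegral
open scoped Topology

namespace Summit.RiemannHypothesis.RiemannHypothesis.Theorems.SpectralTraceWindowStep

open Summit.RiemannHypothesis.RiemannHypothesis.Theorems.WeilWindowFlowStrictUnderRH

/-! ## §1 Two elementary integrals -/

/-- `∫_0^{2π} |sin θ| dθ = 4`. [folklore] -/
theorem integral_abs_sin_eq_four : ∫ θ in (0 : ℝ)..2 * π, |Real.sin θ| = 4 := by
  have h1 : ∫ θ in (0 : ℝ)..π, |Real.sin θ| = 2 := by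
    rw [intervalIntegral.integral_congr (g := Real.sin) ?_]
    · simp [integral_sin]; norm_num
    · intro θ hθ
      rw [uIcc_of_le pi_pos.le] at hθ
      exact abs_of_nonneg (sin_nonneg_of_mem_Icc hθ)
  have h2 : ∫ θ in π..2 * π, |Real.sin θ| = 2 := by
    rw [intervalIntegral.integral_congr (g := fun θ => -Real.sin θ) ?_]
    · simp [integral_sin]; norm_num
    · intro θ hθ
      rw [uIcc_of_le (by linarith [pi_pos])] at hθ
      have : Real.sin θ ≤ 0 := by
        have h := sin_nonpos_of_nonpos_of_neg_pi_le (x := θ - 2 * π) (by linarith [hθ.2])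
          (by linarith [hθ.1])
        rwa [Real.sin_sub_two_pi] at h
      simp [abs_of_nonpos this]
  rw [← intervalIntegral.integral_add_adjacent_intervals (b := π), h1, h2]
  · norm_num
  all_goals exact (continuous_abs.comp Real.continuous_sin).intervalIntegrable _ _

/-- Pointwise domination of the averaging kernel: `log⁺(R/|l − x|) ≤ |log R| + |log (l − x)|`
(with Lean's conventions `log 0 = 0`, `R/0 = 0`). [folklore] -/
theorem posLog_div_abs_sub_le (R l x : ℝ) :
    Real.posLog (R / |l - x|) ≤ |Real.log R| + |Real.log (l - x)| := by
  by_cases hR : R = 0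
  · simp [hR]
  by_cases hx : l - x = 0
  · rw [hx]; simp
  rw [posLog_apply, Real.log_div hR (abs_ne_zero.2 hx), Real.log_abs]
  refine max_le (by positivity) ?_
  linarith [le_abs_self (Real.log R), neg_abs_le (Real.log (l - x))]

/-- The averaging kernel `x ↦ log⁺(R/|l − x|)` is measurable. [folklore] -/
theorem measurable_posLog_div_abs_sub (R l : ℝ) :
    Measurable fun x : ℝ => Real.posLog (R / |l - x|) :=
  continuous_posLog.measurable.comp
    (measurable_const.div (continuous_abs.measurable.comp (measurable_id.const_sub l)))

/-- The averaging kernel `x ↦ log⁺(R/|l − x|)` is interval integrable on every interval (its only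
singularity, at `x = l`, is logarithmic). [folklore] -/
theorem intervalIntegrable_posLog_div_abs_sub (R l a b : ℝ) :
    IntervalIntegrable (fun x => Real.posLog (R / |l - x|)) volume a b := by
  have hlog : IntervalIntegrable (fun x => Real.log (l - x)) volume a b := by
    have h := (intervalIntegrable_log' (a := l - a) (b := l - b)).comp_sub_left l
    simpa using h
  have hg : IntervalIntegrable (fun x => |Real.log R| + |Real.log (l - x)|) volume a b :=
    intervalIntegrable_const.add hlog.abs
  refine hg.mono_fun' (measurable_posLog_div_abs_sub R l).aestronglyMeasurable ?_
  refine Filter.Eventually.of_forall fun x => ?_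
  show ‖Real.posLog (R / |l - x|)‖ ≤ |Real.log R| + |Real.log (l - x)|
  rw [Real.norm_eq_abs, abs_of_nonneg posLog_nonneg]
  exact posLog_div_abs_sub_le R l x

/-- The averaging kernel integrates to `2R`: `∫_{-R}^{R} log⁺(R/|s|) ds = 2R` (`R > 0`). [folklore] -/
theorem integral_posLog_div_abs {R : ℝ} (hR : 0 < R) :
    ∫ s in (-R)..R, Real.posLog (R / |s|) = 2 * R := by
  have hhalf : ∫ s in (0 : ℝ)..R, Real.posLog (R / |s|) = R := by
    have hae : ∀ᵐ s : ℝ, s ∈ Set.uIoc (0 : ℝ) R → Real.posLog (R / |s|) = Real.log R - Real.log s := by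
      refine Filter.Eventually.of_forall fun s hs => ?_
      rw [uIoc_of_le hR.le] at hs
      have hs0 : 0 < s := hs.1
      rw [abs_of_pos hs0, posLog_eq_log, Real.log_div hR.ne' hs0.ne']
      rw [abs_of_pos (div_pos hR hs0), one_le_div hs0]
      exact hs.2
    rw [intervalIntegral.integral_congr_ae hae, intervalIntegral.integral_sub, integral_log,
      intervalIntegral.integral_const]
    · simp
    · exact intervalIntegrable_const
    · exact intervalIntegrable_log'
  have hneg : ∫ s in (-R)..0, Real.posLog (R / |s|) = R := by
    have h := intervalIntegral.integral_comp_neg (a := (0 : ℝ)) (b := R)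
      (f := fun s => Real.posLog (R / |s|))
    simp only [abs_neg, neg_zero] at h
    rw [← h, hhalf]
  rw [← intervalIntegral.integral_add_adjacent_intervals (b := 0), hneg, hhalf]
  · ring
  all_goals simpa using intervalIntegrable_posLog_div_abs_sub R 0 _ _

/-! ## §2 Jensen's formula on a disc centred on the real axis -/

variable {F : ℂ → ℂ} {K B : ℝ}

/-- On the circle `|z − x₀| = R` (real centre) an entire `F` with `‖F z‖ ≤ K e^{B|Im z|}` has
`log ‖F z‖ ≤ log K + B |Im z|` (also at zeros, where Lean's `log 0 = 0`). [folklore] -/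
theorem log_norm_le_of_expType (hK : 1 ≤ K) (hB : 0 ≤ B)
    (hbd : ∀ z : ℂ, ‖F z‖ ≤ K * Real.exp (B * |z.im|)) (z : ℂ) :
    Real.log ‖F z‖ ≤ Real.log K + B * |z.im| := by
  have hK0 : 0 < K := by linarith
  rcases eq_or_ne (F z) 0 with h | h
  · rw [h, norm_zero, Real.log_zero]
    have := Real.log_nonneg hK
    positivity
  · calc Real.log ‖F z‖ ≤ Real.log (K * Real.exp (B * |z.im|)) :=
          Real.log_le_log (norm_pos_iff.2 h) (hbd z)
      _ = Real.log K + B * |z.im| := by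
          rw [Real.log_mul hK0.ne' (Real.exp_pos _).ne', Real.log_exp]

/-- **Mean of `log |F|` on a circle centred on the real axis**: for `F` entire with
`‖F z‖ ≤ K e^{B|Im z|}`, `⨍_{|z−x₀|=R} log |F| ≤ log K + 2BR/π` (`∫_0^{2π} |sin θ| dθ = 4`). [folklore] -/
theorem circleAverage_log_norm_le_of_expType (hF : Differentiable ℂ F) (hK : 1 ≤ K) (hB : 0 ≤ B)
    (hbd : ∀ z : ℂ, ‖F z‖ ≤ K * Real.exp (B * |z.im|)) (x₀ : ℝ) {R : ℝ} (hR : 0 < R) :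
    circleAverage (fun z => Real.log ‖F z‖) (x₀ : ℂ) R ≤ Real.log K + 2 * B * R / π := by
  have han : AnalyticOnNhd ℂ F (sphere (x₀ : ℂ) |R|) := fun z _ => hF.analyticAt z
  have hint : CircleIntegrable (fun z => Real.log ‖F z‖) (x₀ : ℂ) R :=
    han.meromorphicOn.circleIntegrable_log_norm
  have hcont : Continuous fun z : ℂ => Real.log K + B * |z.im| := by fun_prop
  have hg : CircleIntegrable (fun z : ℂ => Real.log K + B * |z.im|) (x₀ : ℂ) R :=
    hcont.continuousOn.circleIntegrable'
  calc circleAverage (fun z => Real.log ‖F z‖) (x₀ : ℂ) R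
      ≤ circleAverage (fun z : ℂ => Real.log K + B * |z.im|) (x₀ : ℂ) R :=
        circleAverage_mono hint hg fun z _ => log_norm_le_of_expType hK hB hbd z
    _ = Real.log K + 2 * B * R / π := by
        rw [circleAverage_def, smul_eq_mul]
        have him : ∀ θ : ℝ, (circleMap (x₀ : ℂ) R θ).im = R * Real.sin θ := by
          intro θ
          simp [circleMap, Complex.exp_mul_I, Complex.add_im, Complex.mul_im, Complex.cos_ofReal_im,
            Complex.sin_ofReal_re]
        simp_rw [him, abs_mul, abs_of_pos hR]
        have hI : ∫ θ in (0 : ℝ)..2 * π, (Real.log K + B * (R * |Real.sin θ|)) =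
            2 * π * Real.log K + B * (R * 4) := by
          rw [intervalIntegral.integral_add (f := fun _ => Real.log K)
            (g := fun θ => B * (R * |Real.sin θ|)) intervalIntegrable_const
            (Continuous.intervalIntegrable (by fun_prop) _ _),
            intervalIntegral.integral_const, intervalIntegral.integral_const_mul,
            intervalIntegral.integral_const_mul, integral_abs_sin_eq_four]
          simp only [sub_zero, smul_eq_mul]
        rw [hI]
        have hπ : (π : ℝ) ≠ 0 := pi_pos.ne'
        field_simp
        ring

/-- **Jensen's inequality averaged kernel form.** For `F` entire with `‖F z‖ ≤ K e^{B|Im z|}`, a real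
`x₀` with `F x₀ ≠ 0`, `R > 0` and a finite set `Z` of real zeros of `F`:
`Σ_{λ ∈ Z} log⁺(R/|λ − x₀|) ≤ log K + 2BR/π + log⁺(1/|F x₀|)`. (Jensen's formula on
`|z − x₀| ≤ R`: every zero `λ` inside carries divisor `≥ 1` and weight `log(R/|λ − x₀|) ≥ 0`, the
other divisor terms are `≥ 0`, the circle mean is `≤ log K + 2BR/π`, and
`−log |F x₀| ≤ log⁺(1/|F x₀|)`.) [folklore] -/
theorem sum_posLog_le_of_expType (hF : Differentiable ℂ F) (hK : 1 ≤ K) (hB : 0 ≤ B)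
    (hbd : ∀ z : ℂ, ‖F z‖ ≤ K * Real.exp (B * |z.im|)) {x₀ : ℝ} (hx₀ : F (x₀ : ℂ) ≠ 0)
    {R : ℝ} (hR : 0 < R) (Z : Finset ℝ) (hZ : ∀ l ∈ Z, F (l : ℂ) = 0) :
    ∑ l ∈ Z, Real.posLog (R / |l - x₀|) ≤
      Real.log K + 2 * B * R / π + Real.posLog ‖F (x₀ : ℂ)‖⁻¹ := by
  have hRabs : |R| = R := abs_of_pos hR
  set CB : Set ℂ := closedBall (x₀ : ℂ) |R| with hCB
  have han : AnalyticOnNhd ℂ F CB := fun z _ => hF.analyticAt z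
  have hJ := han.circleAverage_log_norm hR.ne' hx₀
  set D := MeromorphicOn.divisor F CB with hD
  have hDfin : (Function.support D).Finite := D.finiteSupport (isCompact_closedBall _ _)
  set φ : ℂ → ℝ := fun u => (D u : ℝ) * Real.log (R * ‖(x₀ : ℂ) - u‖⁻¹) with hφ
  -- every term of Jensen's sum is non-negative
  have hlog_nonneg : ∀ u ∈ CB, 0 ≤ Real.log (R * ‖(x₀ : ℂ) - u‖⁻¹) := by
    intro u hu
    rcases eq_or_ne u x₀ with rfl | hne
    · simp
    · have hpos : 0 < ‖(x₀ : ℂ) - u‖ := norm_pos_iff.2 (sub_ne_zero.2 hne.symm)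
      apply Real.log_nonneg
      rw [mem_closedBall, dist_comm, dist_eq_norm, hRabs] at hu
      rw [le_mul_inv_iff₀ hpos, one_mul]
      exact hu
  have hφ_nonneg : ∀ u, 0 ≤ φ u := by
    intro u
    by_cases hu : u ∈ CB
    · exact mul_nonneg (by exact_mod_cast MeromorphicOn.AnalyticOnNhd.divisor_nonneg han u) (hlog_nonneg u hu)
    · simp [hφ, Function.locallyFinsuppWithin.apply_eq_zero_of_notMem D hu]
  -- each real zero contributes at least the kernel
  have hterm : ∀ l ∈ Z, Real.posLog (R / |l - x₀|) ≤ φ (l : ℂ) := by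
    intro l hl
    have hne : l ≠ x₀ := by
      rintro rfl
      exact hx₀ (hZ l hl)
    have habs : 0 < |l - x₀| := abs_pos.2 (sub_ne_zero.2 hne)
    have hnorm : ‖(x₀ : ℂ) - (l : ℂ)‖ = |l - x₀| := by
      rw [← Complex.ofReal_sub, Complex.norm_real, Real.norm_eq_abs, abs_sub_comm]
    by_cases hin : |l - x₀| ≤ R
    · have hmem : (l : ℂ) ∈ CB := by
        rw [hCB, mem_closedBall, dist_comm, dist_eq_norm, hnorm, hRabs]
        exact hin
      have h1 : (1 : ℤ) ≤ D (l : ℂ) := one_le_divisor_of_zero hF hx₀ hmem (hZ l hl)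
      have h1' : (1 : ℝ) ≤ (D (l : ℂ) : ℝ) := by exact_mod_cast h1
      have hker : Real.posLog (R / |l - x₀|) = Real.log (R * ‖(x₀ : ℂ) - (l : ℂ)‖⁻¹) := by
        rw [hnorm, ← div_eq_mul_inv, posLog_eq_log]
        rw [abs_of_pos (div_pos hR habs), one_le_div habs]
        exact hin
      rw [hker]
      have h0 := hlog_nonneg _ hmem
      calc Real.log (R * ‖(x₀ : ℂ) - (l : ℂ)‖⁻¹) = 1 * Real.log (R * ‖(x₀ : ℂ) - (l : ℂ)‖⁻¹) := by ring
        _ ≤ φ (l : ℂ) := mul_le_mul_of_nonneg_right h1' h0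
    · have h0 : Real.posLog (R / |l - x₀|) = 0 := by
        rw [posLog_eq_zero_iff, abs_of_pos (div_pos hR habs), div_le_one habs]
        exact (not_le.1 hin).le
      rw [h0]
      exact hφ_nonneg _
  -- the finite sum over `Z` is dominated by Jensen's sum
  classical
  have hsupp : Function.support φ ⊆ ↑(hDfin.toFinset ∪ Z.image (fun l : ℝ => (l : ℂ))) := by
    intro u hu
    have hDu : D u ≠ 0 := by
      intro h
      apply hu
      simp [hφ, h]
    simp [hDu]
  have hsum : ∑ l ∈ Z, φ (l : ℂ) ≤ ∑ᶠ u, φ u := by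
    rw [finsum_eq_sum_of_support_subset φ hsupp]
    rw [← Finset.sum_image (f := φ) (s := Z) (g := fun l : ℝ => (l : ℂ))
      (fun a _ b _ h => Complex.ofReal_injective h)]
    exact Finset.sum_le_sum_of_subset_of_nonneg Finset.subset_union_right fun u _ _ => hφ_nonneg u
  have hneglog : -Real.log ‖F (x₀ : ℂ)‖ ≤ Real.posLog ‖F (x₀ : ℂ)‖⁻¹ := by
    have := Real.posLog_sub_posLog_inv (x := ‖F (x₀ : ℂ)‖)
    linarith [posLog_nonneg (x := ‖F (x₀ : ℂ)‖)]
  calc ∑ l ∈ Z, Real.posLog (R / |l - x₀|) ≤ ∑ l ∈ Z, φ (l : ℂ) := Finset.sum_le_sum hterm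
    _ ≤ ∑ᶠ u, φ u := hsum
    _ = circleAverage (fun z => Real.log ‖F z‖) (x₀ : ℂ) R - Real.log ‖F (x₀ : ℂ)‖ := by
        rw [hJ]; ring
    _ ≤ Real.log K + 2 * B * R / π - Real.log ‖F (x₀ : ℂ)‖ := by
        linarith [circleAverage_log_norm_le_of_expType hF hK hB hbd x₀ hR]
    _ ≤ Real.log K + 2 * B * R / π + Real.posLog ‖F (x₀ : ℂ)‖⁻¹ := by linarith



/-- **Registered helper `realZeroDensity_jensenKernelBound`** (closed form of
`sum_posLog_le_of_expType`, the deliverable of this auxiliary file toward the registered stub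
`stub_realZeroDensityOfLogInt`): for `F` entire with `‖F z‖ ≤ K e^{B|Im z|}`, a real `x₀` with
`F x₀ ≠ 0`, `R > 0` and a finite set `Z` of real zeros,
`Σ_{λ ∈ Z} log⁺(R/|λ − x₀|) ≤ log K + 2BR/π + log⁺(1/|F x₀|)`. [folklore] -/
theorem realZeroDensity_jensenKernelBound : ∀ (F : ℂ → ℂ) (K B : ℝ), Differentiable ℂ F → 1 ≤ K → 0 ≤ B → (∀ z : ℂ, ‖F z‖ ≤ K * Real.exp (B * |z.im|)) → ∀ x₀ : ℝ, F (x₀ : ℂ) ≠ 0 → ∀ R : ℝ, 0 < R → ∀ Z : Finset ℝ, (∀ l ∈ Z, F (l : ℂ) = 0) → ∑ l ∈ Z, Real.posLog (R / |l - x₀|) ≤ Real.log K + 2 * B * R / Real.pi + Real.posLog ‖F (x₀ : ℂ)‖⁻¹ :=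
  fun _ _ _ hF hK hB hbd _ hx₀ _ hR Z hZ => sum_posLog_le_of_expType hF hK hB hbd hx₀ hR Z hZ

end Summit.RiemannHypothesis.RiemannHypothesis.Theorems.SpectralTraceWindowStep

end
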